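import Summits.ValiantsHypothesis.ValiantsHypothesis.Theses.SummationBits
import Summits.ValiantsHypothesis.ValiantsHypothesis.Theorems.SummationBitsDepth3ThesisStubFlattening
import Summits.ValiantsHypothesis.ValiantsHypothesis.Theorems.SummationBitsDepth3ThesisStubBinomialGrowth
import Summits.ValiantsHypothesis.ValiantsHypothesis.Theorems.SummationBitsDepth3ThesisStubMidGrowth

/-!
# Skeleton for crux `Depth3Thesis` (item stmt-ValiantsHypothesis-5934), line `birth` — rev 3

Route `route-ValiantsHypothesis-SummationBits` (the decl is SHARED verbatim with route
`route-ValiantsHypothesis-ChowBorderDepth3`; one ledger item, two identical `def`s).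
Crux (route decl `Summit.ValiantsHypothesis.ValiantsHypothesis.Theses.SummationBits.Depth3Thesis`):
for every `c` there is an `n` such that every product-depth-`≤ 1` (ΣΠΣ) circuit over `ℂ` computing
`per_n` has MORE than `(n+2)^(c⌊√n⌋+c)` wires.

LINE (regime decomposition by the degree `D` of the ΠΣ products). By the PROVED support item
`SPSNormalForm` (`SPSNormalForm_holds`, tree) a circuit with `E` wires is an affine ΣΠΣ expression
`per_n = Σ_{i<r} Π_{j<D} ℓ_ij` with `r = D = E + 1`. Then:

* `stub_flattening` — CLOSED (landed `Theorems/SummationBitsDepth3ThesisStubFlattening.lean`,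
  p147190): the Nisan–Wigderson flattening count for AFFINE ΣΠΣ expressions of `per_n`, uniformly
  in the order `k` and the degree `D`: `binom(n,k)² ≤ r · binom(D,k)`.
* `stub_binomialGrowth` — CLOSED (landed `Theorems/SummationBitsDepth3ThesisStubBinomialGrowth.lean`,
  p148239): for `D ≤ 2n`, `(n+2)^(c⌊√n⌋+c) · binom(D,⌊n/2⌋) < binom(n,⌊n/2⌋)²` eventually.
* rev 2 RESHAPE of the former open stub `stub_interpolationRegime` (`D > 2n`) into the part the
  flattenings still own and the honest residual:
  * `stub_midGrowth` — CLOSED (rev 3; landed `Theorems/SummationBitsDepth3ThesisStubMidGrowth.lean`,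
    p149895): the arithmetic of the EXTENDED flattening regime
    `2n < D ≤ n² / (4k)`, `k := (c⌊√n⌋+c+1)(⌊log₂(n+2)⌋+1)`: there is an order `k` with
    `(n+2)^(c⌊√n⌋+c) · binom(D,k) < binom(n,k)²` (take that `k`: `k!·binom(n,k) ≥ (n+1-k)^k`,
    `k!·binom(D,k) ≤ D^k`, `(n+1-k)² ≥ 2kD` and `2^k > (n+2)^(c⌊√n⌋+c)`).
    With `stub_flattening` it gives `r > (n+2)^(c⌊√n⌋+c)` for all `D` up to `≈ n^{3/2}/(4(c+1) log₂ n)`,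
    which is where the method of partial derivatives provably stops (`binom(D,k)` swamps `binom(n,k)²`
    for every `k` once `D ≳ n²/k`, and `k ≲ √n log n` is forced by the threshold).
  * `stub_highRegime` — THE LOAD-BEARING STUB (open): for `n ≥ n₀(c)`, an affine ΣΠΣ expression of
    `per_n` whose degree lies in the window `n²/(4k) < D < (n+2)^(c⌊√n⌋+c)` (beyond every flattening,
    below the trivial wire count) still has `(n+2)^(c⌊√n⌋+c) < r · (D+1)`. This is the crux restricted
    to the one regime no known measure covers (only `n^{Ω(√log n)}` is known there, LST 2021).
    CERTIFICATE of its size (rev 3, kernel-checked below): with the three landed stubs, the PROVED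
    chasm `Depth3Chasm_holds` and the PROVED `Assembly_holds`, `Stmt.stub_highRegime` alone implies
    the summit `ValiantsHypothesis` (`valiantsHypothesis_of_stub_highRegime`).

`Depth3Thesis_of` assembles them (real proof): fix `c`, take `n` beyond the `n₀` of stub 2 at `c+1`
and of stub 4 at `2c+2` (and `≥ 1`), normalise a putative cheap circuit (`E ≤ (n+2)^(c⌊√n⌋+c)`) by
`SPSNormalForm_holds`, and split: `E + 1 ≤ 2n` → stubs 1+2 give `(n+2)^((c+1)⌊√n⌋+(c+1)) < E + 1`;
`2n < E + 1` and `(E+1)·4k ≤ n²` → stubs 1+3 give `(n+2)^((2c+2)⌊√n⌋+(2c+2)) < E + 1`; otherwise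
stub 4 gives `(n+2)^((2c+2)⌊√n⌋+(2c+2)) < (E+1)(E+2)`; all three contradict `E ≤ (n+2)^(c⌊√n⌋+c)` by
the threshold arithmetic `threshold_two_mul_le`, `threshold_nine_sq_le`.

## Shape (skeleton audit by-name rule)
* `Stmt.stub_…` — the four stub statements as precise `Prop`s, named like the stubs;
* `stub_…` — the same statements as theorems: stubs 1–3 are closed by the landed tree theorems,
  stub 4 is sorried (the one REGISTERED open stub; `sorry` occurs nowhere else);
* `Depth3Thesis_of : Stmt.stub_flattening → Stmt.stub_binomialGrowth → Stmt.stub_midGrowth →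
  Stmt.stub_highRegime → Depth3Thesis` — the composition, real proof; `Depth3Thesis_proof` ties the
  copies, and `Depth3Thesis_proof_chowBorderDepth3` records by `rfl`-transport that the
  ChowBorderDepth3 copy of the shared decl is the same proposition.
All stubs are DEF-FREE beyond Mathlib + `Literature.Computability.AlgebraicComplexity.perPoly`, so
each can land as `Theorems/SummationBitsDepth3Thesis<Stub>.lean` with `--supports stmt-ValiantsHypothesis-5934`.
-/

-- `Summit.ValiantsHypothesis.ValiantsHypothesis.…` is the tree's mandated single-conjunct layout.
set_option linter.dupNamespace false

namespace Summit.ValiantsHypothesis.ValiantsHypothesis.Cruxes.Depth3Thesis.Birth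

open Literature.Computability.AlgebraicComplexity

/-- Statement of STUB 1 (Nisan–Wigderson flattening count for affine ΣΠΣ expressions of the
permanent, all orders `k` and all product degrees `D`). If `per_n = Σ_{i<r} Π_{j<D} ℓ_ij` with
`ℓ_ij ∈ ℂ[x]` of total degree `≤ 1`, then `binom(n,k)² ≤ r · binom(D,k)`. CLOSED (p147190).
[cite: NisanWigderson1996, §3] [cite: Landsberg2017, Prop. 7.2.2.1] -/
def Stmt.stub_flattening : Prop :=
  ∀ (n k r D : ℕ) (ℓ : Fin r → Fin D → MvPolynomial (Fin n × Fin n) ℂ),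
    (∀ i j, (ℓ i j).totalDegree ≤ 1) →
      (∑ i, ∏ j, ℓ i j) = perPoly (Fin n) ℂ → (n.choose k) ^ 2 ≤ r * D.choose k

/-- Statement of STUB 2 (the arithmetic of the flattening regime `D ≤ 2n`). For every `c` and all
large `n`: `(n+2)^(c⌊√n⌋+c) · binom(D,⌊n/2⌋) < binom(n,⌊n/2⌋)²` whenever `D ≤ 2n`. CLOSED (p148239). -/
def Stmt.stub_binomialGrowth : Prop :=
  ∀ c : ℕ, ∃ n₀ : ℕ, ∀ n D : ℕ, n₀ ≤ n → D ≤ 2 * n →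
    (n + 2) ^ (c * Nat.sqrt n + c) * D.choose (n / 2) < (n.choose (n / 2)) ^ 2

/-- Statement of STUB 3 (rev 2; the arithmetic of the EXTENDED flattening regime). For all `c n D`
with `2n < D` and `D · 4k ≤ n²`, `k := (c⌊√n⌋+c+1)(⌊log₂(n+2)⌋+1)`, some order `k'` has
`(n+2)^(c⌊√n⌋+c) · binom(D,k') < binom(n,k')²`.
Why plausibly true (it is, with `k' = k`): `k!·binom(n,k) = n(n-1)⋯(n-k+1) ≥ (n+1-k)^k`
(`Nat.pow_sub_le_descFactorial`), `k!·binom(D,k) ≤ D^k` (`Nat.descFactorial_le_pow`), `k! ≤ k^k`;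
the hypotheses give `8k < n`, hence `(n+1-k)² ≥ (7n/8)² ≥ 2kD`, so
`(k!)²·binom(n,k)² ≥ ((n+1-k)²)^k ≥ (2kD)^k = 2^k (kD)^k > (n+2)^(c⌊√n⌋+c) · k^k · D^k ≥
(k!)² · (n+2)^(c⌊√n⌋+c) · binom(D,k)`, using `2^k = (2^(⌊log₂(n+2)⌋+1))^(c⌊√n⌋+c+1) > (n+2)^(c⌊√n⌋+c)`.
Why it might fail: it cannot; pure ℕ bookkeeping, no `n₀` needed. Size: S/M. [folklore] -/
def Stmt.stub_midGrowth : Prop :=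
  ∀ (c n D : ℕ), 2 * n < D →
    D * (4 * ((c * Nat.sqrt n + c + 1) * (Nat.log 2 (n + 2) + 1))) ≤ n ^ 2 →
      ∃ k, (n + 2) ^ (c * Nat.sqrt n + c) * D.choose k < (n.choose k) ^ 2

/-- Statement of STUB 4 (rev 2; the high-degree residual — the load-bearing OPEN step). For every
`c` and all large `n`: an affine ΣΠΣ expression `per_n = Σ_{i<r} Π_{j<D} ℓ_ij` over `ℂ` whose product
degree lies beyond every flattening, `n² < D · 4k` (`k := (c⌊√n⌋+c+1)(⌊log₂(n+2)⌋+1)`, i.e.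
`D ≳ n^{3/2}/(4(c+1) log₂ n)`), and below the trivial wire count, `D < (n+2)^(c⌊√n⌋+c)`, still has
`(n+2)^(c⌊√n⌋+c) < r · (D+1)`.
Why plausibly true: no sub-chasm depth-three expression of `per_n` is known in ANY degree regime
(records Ryser/Glynn have `D = n`); over finite fields high-degree products are provably useless
(Grigoriev–Razborov 2000). Why it might fail: false iff `per_n` has ΣΠΣ expressions with
`(n+2)^(O(√n))` wires using products of degree `≫ n^{3/2}` infinitely often (a duality-trick /
Ben-Or interpolation circuit for `per`, as GKKS build for `det`, arXiv:1304.5777 p. 3); in this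
window flattenings are blind (`binom(D,k) ≥ binom(n,k)²·poly` for all `k`), the wire count is blind,
and the best known bound is `n^{Ω(√log n)}` (Limaye–Srinivasan–Tavenas 2021). Size: open problem
(the crux's hard core; with stubs 1–3 and `Depth3Chasm` it implies the summit).
[cite: GuptaKamathKayalSaptharishi2016] [cite: LimayeSrinivasanTavenas2021] [cite: NisanWigderson1996] -/
def Stmt.stub_highRegime : Prop :=
  ∀ c : ℕ, ∃ n₀ : ℕ, ∀ n : ℕ, n₀ ≤ n →
    ∀ (r D : ℕ) (ℓ : Fin r → Fin D → MvPolynomial (Fin n × Fin n) ℂ),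
      (∀ i j, (ℓ i j).totalDegree ≤ 1) → 2 * n < D →
        n ^ 2 < D * (4 * ((c * Nat.sqrt n + c + 1) * (Nat.log 2 (n + 2) + 1))) →
          D < (n + 2) ^ (c * Nat.sqrt n + c) →
            (∑ i, ∏ j, ℓ i j) = perPoly (Fin n) ℂ →
              (n + 2) ^ (c * Nat.sqrt n + c) < r * (D + 1)

/-- Registered STUB 1 = `Stmt.stub_flattening` — CLOSED by the landed tree theorem
`Summit.ValiantsHypothesis.ValiantsHypothesis.Theorems.SummationBitsDepth3Thesis.stub_flattening`
(p147190). [cite: NisanWigderson1996, §3] -/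
theorem stub_flattening :
    ∀ (n k r D : ℕ) (ℓ : Fin r → Fin D → MvPolynomial (Fin n × Fin n) ℂ),
      (∀ i j, (ℓ i j).totalDegree ≤ 1) →
        (∑ i, ∏ j, ℓ i j) = perPoly (Fin n) ℂ → (n.choose k) ^ 2 ≤ r * D.choose k :=
  Summit.ValiantsHypothesis.ValiantsHypothesis.Theorems.SummationBitsDepth3Thesis.stub_flattening

/-- Registered STUB 2 = `Stmt.stub_binomialGrowth` — CLOSED by the landed tree theorem
`Summit.ValiantsHypothesis.ValiantsHypothesis.Theorems.SummationBitsDepth3Thesis.stub_binomialGrowth`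
(p148239). -/
theorem stub_binomialGrowth :
    ∀ c : ℕ, ∃ n₀ : ℕ, ∀ n D : ℕ, n₀ ≤ n → D ≤ 2 * n →
      (n + 2) ^ (c * Nat.sqrt n + c) * D.choose (n / 2) < (n.choose (n / 2)) ^ 2 :=
  Summit.ValiantsHypothesis.ValiantsHypothesis.Theorems.SummationBitsDepth3Thesis.stub_binomialGrowth

/-- Registered STUB 3 (rev 2) = `Stmt.stub_midGrowth` (arithmetic of the extended flattening regime
`2n < D ≤ n²/(4k)`) — CLOSED (rev 3) by the landed tree theorem
`Summit.ValiantsHypothesis.ValiantsHypothesis.Theorems.SummationBitsDepth3Thesis.stub_midGrowth`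
(p149895). [folklore] -/
theorem stub_midGrowth :
    ∀ (c n D : ℕ), 2 * n < D →
      D * (4 * ((c * Nat.sqrt n + c + 1) * (Nat.log 2 (n + 2) + 1))) ≤ n ^ 2 →
        ∃ k, (n + 2) ^ (c * Nat.sqrt n + c) * D.choose k < (n.choose k) ^ 2 :=
  Summit.ValiantsHypothesis.ValiantsHypothesis.Theorems.SummationBitsDepth3Thesis.stub_midGrowth

/-- Registered STUB 4 (rev 2) = `Stmt.stub_highRegime` (the chasm threshold for wires in the
window `n²/(4k) < D < (n+2)^(c⌊√n⌋+c)`; the open, load-bearing step).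
[cite: GuptaKamathKayalSaptharishi2016] -/
theorem stub_highRegime :
    ∀ c : ℕ, ∃ n₀ : ℕ, ∀ n : ℕ, n₀ ≤ n →
      ∀ (r D : ℕ) (ℓ : Fin r → Fin D → MvPolynomial (Fin n × Fin n) ℂ),
        (∀ i j, (ℓ i j).totalDegree ≤ 1) → 2 * n < D →
          n ^ 2 < D * (4 * ((c * Nat.sqrt n + c + 1) * (Nat.log 2 (n + 2) + 1))) →
            D < (n + 2) ^ (c * Nat.sqrt n + c) →
              (∑ i, ∏ j, ℓ i j) = perPoly (Fin n) ℂ →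
                (n + 2) ^ (c * Nat.sqrt n + c) < r * (D + 1) := by
  sorry

/-! ### Threshold arithmetic (sorry-free glue used by the composition) -/

/-- `2 · (n+2)^(c⌊√n⌋+c) ≤ (n+2)^((c+1)⌊√n⌋+(c+1))`. -/
theorem threshold_two_mul_le (n c : ℕ) :
    2 * (n + 2) ^ (c * Nat.sqrt n + c) ≤ (n + 2) ^ ((c + 1) * Nat.sqrt n + (c + 1)) := by
  calc 2 * (n + 2) ^ (c * Nat.sqrt n + c)
      ≤ (n + 2) ^ (Nat.sqrt n + 1) * (n + 2) ^ (c * Nat.sqrt n + c) := by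
        apply Nat.mul_le_mul_right
        calc 2 ≤ n + 2 := by omega
          _ = (n + 2) ^ 1 := (pow_one _).symm
          _ ≤ (n + 2) ^ (Nat.sqrt n + 1) := Nat.pow_le_pow_right (by omega) (by omega)
    _ = (n + 2) ^ ((c + 1) * Nat.sqrt n + (c + 1)) := by
        rw [← pow_add]; congr 1; ring

/-- `9 · ((n+2)^(c⌊√n⌋+c))² ≤ (n+2)^((2c+2)⌊√n⌋+(2c+2))` for `n ≥ 1`. -/
theorem threshold_nine_sq_le (n c : ℕ) (hn : 1 ≤ n) :
    9 * ((n + 2) ^ (c * Nat.sqrt n + c)) ^ 2 ≤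
      (n + 2) ^ ((2 * c + 2) * Nat.sqrt n + (2 * c + 2)) := by
  calc 9 * ((n + 2) ^ (c * Nat.sqrt n + c)) ^ 2
      ≤ (n + 2) ^ (2 * Nat.sqrt n + 2) * ((n + 2) ^ (c * Nat.sqrt n + c)) ^ 2 := by
        apply Nat.mul_le_mul_right
        calc 9 = 3 ^ 2 := by norm_num
          _ ≤ (n + 2) ^ 2 := Nat.pow_le_pow_left (by omega) 2
          _ ≤ (n + 2) ^ (2 * Nat.sqrt n + 2) := Nat.pow_le_pow_right (by omega) (by omega)
    _ = (n + 2) ^ ((2 * c + 2) * Nat.sqrt n + (2 * c + 2)) := by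
        rw [← pow_mul, ← pow_add]; congr 1; ring

/-- The composition at ONE size `n ≥ 1` (the four stubs specialised to `n` and to the exponents
`c+1`, `2c+2` the bookkeeping needs): every product-depth-`≤ 1` circuit computing `per_n` has more
than `(n+2)^(c⌊√n⌋+c)` wires. Uses the PROVED support item `SPSNormalForm` (`SPSNormalForm_holds`).
Three regimes for the normal form `r = D = E + 1`: `D ≤ 2n` (stubs 1+2), `2n < D`, `4kD ≤ n²`
(stubs 1+3), and the high window (stub 4, whose side condition `D < threshold` is automatic). -/
theorem compose_at {n c : ℕ} (hn : 1 ≤ n)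
    (hFlat : ∀ (k r D : ℕ) (ℓ : Fin r → Fin D → MvPolynomial (Fin n × Fin n) ℂ),
      (∀ i j, (ℓ i j).totalDegree ≤ 1) → (∑ i, ∏ j, ℓ i j) = perPoly (Fin n) ℂ →
        (n.choose k) ^ 2 ≤ r * D.choose k)
    (hGrowth : ∀ D : ℕ, D ≤ 2 * n →
      (n + 2) ^ ((c + 1) * Nat.sqrt n + (c + 1)) * D.choose (n / 2) < (n.choose (n / 2)) ^ 2)
    (hMid : ∀ D : ℕ, 2 * n < D →
      D * (4 * (((2 * c + 2) * Nat.sqrt n + (2 * c + 2) + 1) * (Nat.log 2 (n + 2) + 1))) ≤ n ^ 2 →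
        ∃ k, (n + 2) ^ ((2 * c + 2) * Nat.sqrt n + (2 * c + 2)) * D.choose k < (n.choose k) ^ 2)
    (hHigh : ∀ (r D : ℕ) (ℓ : Fin r → Fin D → MvPolynomial (Fin n × Fin n) ℂ),
      (∀ i j, (ℓ i j).totalDegree ≤ 1) → 2 * n < D →
        n ^ 2 < D * (4 * (((2 * c + 2) * Nat.sqrt n + (2 * c + 2) + 1) * (Nat.log 2 (n + 2) + 1))) →
          D < (n + 2) ^ ((2 * c + 2) * Nat.sqrt n + (2 * c + 2)) →
            (∑ i, ∏ j, ℓ i j) = perPoly (Fin n) ℂ →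
              (n + 2) ^ ((2 * c + 2) * Nat.sqrt n + (2 * c + 2)) < r * (D + 1))
    (P : ArithCircuit ℂ (Fin n × Fin n)) (hP : P.Computes (perPoly (Fin n) ℂ))
    (hd : P.productDepth ≤ 1) :
    (n + 2) ^ (c * Nat.sqrt n + c) < P.edgeSize := by
  -- normal form: `per_n = Σ_{i ≤ E} Π_{j ≤ E} ℓ_ij`, affine `ℓ_ij`, `E = P.edgeSize`
  have hNF := Summit.ValiantsHypothesis.ValiantsHypothesis.Theses.SummationBits.SPSNormalForm_holds
  unfold Summit.ValiantsHypothesis.ValiantsHypothesis.Theses.SummationBits.SPSNormalForm at hNF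
  obtain ⟨ℓ, hℓ, hsum⟩ := hNF n P hP hd
  by_contra hlt
  set T : ℕ := (n + 2) ^ (c * Nat.sqrt n + c) with hT
  have hE : P.edgeSize ≤ T := not_lt.mp hlt
  have hT1 : 1 ≤ T := Nat.one_le_pow _ _ (by omega)
  have h9 := threshold_nine_sq_le n c hn
  rw [← hT] at h9
  have hsq : (P.edgeSize + 1) * (P.edgeSize + 1 + 1) ≤ 9 * T ^ 2 := by nlinarith [hE, hT1]
  rcases Nat.lt_or_ge (2 * n) (P.edgeSize + 1) with hD | hD
  · rcases Nat.lt_or_ge (n ^ 2) ((P.edgeSize + 1) *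
        (4 * (((2 * c + 2) * Nat.sqrt n + (2 * c + 2) + 1) * (Nat.log 2 (n + 2) + 1)))) with hhigh | hmid
    · -- high window: stub 4 (its side condition `D < threshold` is automatic here)
      have hDT : P.edgeSize + 1 < (n + 2) ^ ((2 * c + 2) * Nat.sqrt n + (2 * c + 2)) :=
        calc P.edgeSize + 1 < (P.edgeSize + 1) * (P.edgeSize + 1 + 1) := by nlinarith
          _ ≤ 9 * T ^ 2 := hsq
          _ ≤ (n + 2) ^ ((2 * c + 2) * Nat.sqrt n + (2 * c + 2)) := h9
      have h1 := hHigh (P.edgeSize + 1) (P.edgeSize + 1) ℓ hℓ hD hhigh hDT hsum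
      have : (P.edgeSize + 1) * (P.edgeSize + 1 + 1) < (P.edgeSize + 1) * (P.edgeSize + 1 + 1) :=
        calc (P.edgeSize + 1) * (P.edgeSize + 1 + 1) ≤ 9 * T ^ 2 := hsq
          _ ≤ (n + 2) ^ ((2 * c + 2) * Nat.sqrt n + (2 * c + 2)) := h9
          _ < (P.edgeSize + 1) * (P.edgeSize + 1 + 1) := h1
      exact lt_irrefl _ this
    · -- extended flattening regime (`2n < E + 1`, `4k(E+1) ≤ n²`): stubs 1 + 3
      obtain ⟨k, hk⟩ := hMid (P.edgeSize + 1) hD hmid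
      have h1 := hFlat k (P.edgeSize + 1) (P.edgeSize + 1) ℓ hℓ hsum
      have h3 : (n + 2) ^ ((2 * c + 2) * Nat.sqrt n + (2 * c + 2)) < P.edgeSize + 1 :=
        Nat.lt_of_mul_lt_mul_right (hk.trans_le h1)
      have : P.edgeSize + 1 < P.edgeSize + 1 :=
        calc P.edgeSize + 1 ≤ (P.edgeSize + 1) * (P.edgeSize + 1 + 1) := Nat.le_mul_of_pos_right _ (by omega)
          _ ≤ 9 * T ^ 2 := hsq
          _ ≤ (n + 2) ^ ((2 * c + 2) * Nat.sqrt n + (2 * c + 2)) := h9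
          _ < P.edgeSize + 1 := h3
      exact lt_irrefl _ this
  · -- flattening regime (`E + 1 ≤ 2n`): stubs 1 + 2 at order `k = ⌊n/2⌋`
    have h1 := hFlat (n / 2) (P.edgeSize + 1) (P.edgeSize + 1) ℓ hℓ hsum
    have h2 := hGrowth (P.edgeSize + 1) hD
    have h3 : (n + 2) ^ ((c + 1) * Nat.sqrt n + (c + 1)) < P.edgeSize + 1 :=
      Nat.lt_of_mul_lt_mul_right (h2.trans_le h1)
    have h4 := threshold_two_mul_le n c
    rw [← hT] at h4
    have : P.edgeSize + 1 < P.edgeSize + 1 :=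
      calc P.edgeSize + 1 ≤ 2 * T := by omega
        _ ≤ (n + 2) ^ ((c + 1) * Nat.sqrt n + (c + 1)) := h4
        _ < P.edgeSize + 1 := h3
    exact lt_irrefl _ this

/-- COMPOSITION (kernel-checked, no sorry): the four stub statements imply the crux `Depth3Thesis`
BY NAME. Fix `c`; take `n` beyond the `n₀` of STUB 2 at `c+1` and of STUB 4 at `2c+2` (and `≥ 1`);
conclude by `compose_at`. -/
theorem Depth3Thesis_of :
    Stmt.stub_flattening → Stmt.stub_binomialGrowth → Stmt.stub_midGrowth → Stmt.stub_highRegime →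
      Summit.ValiantsHypothesis.ValiantsHypothesis.Theses.SummationBits.Depth3Thesis := by
  intro hFlat hGrowth hMid hHigh
  unfold Stmt.stub_flattening at hFlat
  unfold Stmt.stub_binomialGrowth at hGrowth
  unfold Stmt.stub_midGrowth at hMid
  unfold Stmt.stub_highRegime at hHigh
  intro c
  obtain ⟨n₂, hn₂⟩ := hGrowth (c + 1)
  obtain ⟨n₄, hn₄⟩ := hHigh (2 * c + 2)
  refine ⟨n₂ + n₄ + 1, fun P hP hd => ?_⟩
  exact compose_at (n := n₂ + n₄ + 1) (c := c) (by omega)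
    (fun k r D ℓ hℓ hsum => hFlat _ k r D ℓ hℓ hsum)
    (fun D hD => hn₂ _ D (by omega) hD)
    (fun D hD hmid => hMid (2 * c + 2) _ D hD hmid)
    (fun r D ℓ hℓ hD hhigh hDT hsum => hn₄ _ (by omega) r D ℓ hℓ hD hhigh hDT hsum)
    P hP hd

/-- THE SKELETON: the crux, modulo exactly the registered open stubs (the compiler checks that the
`Stmt` copies and the stub statements agree). -/
theorem Depth3Thesis_proof :
    Summit.ValiantsHypothesis.ValiantsHypothesis.Theses.SummationBits.Depth3Thesis :=
  Depth3Thesis_of stub_flattening stub_binomialGrowth stub_midGrowth stub_highRegime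

/-- The item is shared verbatim with route ChowBorderDepth3: its copy of the decl is the same
proposition (definitional unfolding), so the skeleton serves both routes. -/
theorem Depth3Thesis_proof_chowBorderDepth3 :
    Summit.ValiantsHypothesis.ValiantsHypothesis.Theses.ChowBorderDepth3.Depth3Thesis :=
  Depth3Thesis_proof

/-- SORRY-FREE reduction of the crux to the one open stub: the three landed stubs make
`Stmt.stub_highRegime → Depth3Thesis` a theorem of the tree's vocabulary. -/
theorem Depth3Thesis_of_stub_highRegime (h : Stmt.stub_highRegime) :
    Summit.ValiantsHypothesis.ValiantsHypothesis.Theses.SummationBits.Depth3Thesis :=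
  Depth3Thesis_of stub_flattening stub_binomialGrowth stub_midGrowth h

/-- CERTIFICATE that the open stub is summit-sized (sorry-free): with the landed stubs, the PROVED
chasm `Depth3Chasm_holds` (item 5935), the PROVED `Assembly_holds` (item 5941) and the tree facts
`totalDegree_perPoly_holds`, `mem_VP_ofFintype_iff_holds`, `perFamily_mem_VNP_holds`,
`Stmt.stub_highRegime` alone implies `ValiantsHypothesis` (`VP ℂ ≠ VNP ℂ`). So no line can close
this stub short of settling the summit; it is the crux's (indeed the summit's) hard core, now
localised to the window `n²/(4k) < D < (n+2)^(c⌊√n⌋+c)`. -/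
theorem valiantsHypothesis_of_stub_highRegime (h : Stmt.stub_highRegime) : ValiantsHypothesis :=
  Summit.ValiantsHypothesis.ValiantsHypothesis.Theses.SummationBits.Assembly_holds
    Summit.ValiantsHypothesis.ValiantsHypothesis.Theses.SummationBits.Depth3Chasm_holds
    (Depth3Thesis_of_stub_highRegime h)
    (fun n => by
      rw [Literature.Computability.AlgebraicComplexity.totalDegree_perPoly_holds (n := Fin n) (k := ℂ),
        Fintype.card_fin])
    (Literature.Computability.AlgebraicComplexity.mem_VP_ofFintype_iff_holds _)
    (Literature.Computability.AlgebraicComplexity.perFamily_mem_VNP_holds ℂ)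

end Summit.ValiantsHypothesis.ValiantsHypothesis.Cruxes.Depth3Thesis.Birth
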